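/-
Copyright (c) 2026. All rights reserved.
Released under Apache 2.0 license as described in the file LICENSE.
Authors: abc-iut cell, prover seat abc-iut-w5-d038 (gen 8; PROOF-ONLY: (FC) «finitely many cusp classes»
for the Möbius deck group of the GENUINE plane domain `ℂ ∖ F`, by transport to the Riemann sphere;
row «FC-TOPOLOGICAL», brick «FC-PLANE»).
-/
import Literature.AnabelianGeometry.AbsoluteAnabelian.ArchimedeanHolFieldFunctorGeometricPSLCuspClasses
import Literature.AnabelianGeometry.AbsoluteAnabelian.ArchimedeanHolFieldFunctorGeometricOverIdRigidInstances
import Literature.Geometry.Kaehler.RiemannSphere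
import HarnessLib

/-!
# Punctures exhaust the cusps, III: the plane domains `ℂ ∖ F` via the Riemann sphere (PROOF-ONLY)

S. Mochizuki, *Topics in Absolute Anabelian Geometry III*, proof of Prop. 4.2 (i) (p. 106): finiteness
of `N_{PSL₂(ℝ)}(Λ̄)/Λ̄` at the uniformised model; in the tree from (P) + (FC) (abc-iut-L4-d1,
`HolRS.finiteIndex_subgroupOf_normalizer_of_cusps`, p460349).  abc-iut-w5-d038's `HolRS.cuspClasses_finite'`
(`…PSLCuspClasses.lean`) proves (FC) for the Möbius deck group of a holomorphic `ℍ`-covering of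
`U = M ∖ S`, `M` a COMPACT Riemann surface.  The genuine plane domain `ℂ ∖ F` (`F` finite; abc-iut-L4-t14's
object `planeComplFinite F hF`, IUT's `(0, r)` bases) is `(ℂ ∪ {∞}) ∖ (F ∪ {∞})` in the tree's Riemann
sphere (`Literature/Geometry/Kaehler/RiemannSphere.lean`, Farkas–Kra I.1.3: `OnePoint ℂ` with its two
charts, compact), so (FC) follows by transporting the covering along the holomorphic open embedding
`ℂ ↪ ℂ ∪ {∞}`:

* `HolRS.planeComplHomeomorph` is NOT defined — the homeomorphism `ℂ ∖ F ≃ₜ ι(ℂ ∖ F)` is built inside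
  the proof (`Homeomorph` from the finite chart `RiemannSphere.coeChart`); no definition is added;
* ★ `HolRS.cuspClasses_finite_planeComplFinite` — **(FC) for the Möbius deck group of EVERY holomorphic
  covering `k : ℍ → ℂ ∖ F`**, `F` finite, in abc-iut-L4-d1's binder shape (the frame of
  abc-iut-w6-d031's `exists_parabolic_mem_of_cover_planeComplFinite`, (P), p476201): together they
  discharge `hN` of abc-iut-L4-t14's `isIdRigid_EA_mapsTo_planeComplFinite_of_hN` for the NON-arithmetic
  `ℂ ∖ F`, `|F| ≥ 3`, as well.

PROOF-ONLY (no definition, no instance, no named fact); MODEL side of [AbsTopIII] §4; classical; nothing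
here bears on the disputed [IUTchIII] Cor. 3.12.

## References

* S. Mochizuki, *Topics in Absolute Anabelian Geometry III* (2015), proof of Prop. 4.2 (i) p.106,
  Def. 4.1 (i) p.101. [MochizukiAbsTopIII2015]
* H. M. Farkas, I. Kra, *Riemann Surfaces*, 2nd ed. (1992), §I.1.3, IV.5.5–IV.5.6, IV.6. [FarkasKra1992]
-/

set_option autoImplicit false

noncomputable section

open Complex Filter Topology Set Function
open scoped UpperHalfPlane MatrixGroups Matrix Manifold ContDiff OnePoint
open _root_.TopologicalSpace (Opens)
open Literature.Geometry.Kaehler (RiemannSphere.coeChart RiemannSphere.coeChart_coe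
  RiemannSphere.coeChart_source RiemannSphere.mdifferentiableAt_coe_comp_iff)

namespace Literature.AnabelianGeometry.AbsoluteAnabelian

namespace HolRS

/-- ★ **(FC) for the Möbius deck group of `ℂ ∖ F`** (`F ⊆ ℂ` finite): for EVERY holomorphic covering
`k : ℍ → ℂ ∖ F` and its Möbius deck group `Λ̄ ≤ PSL₂(ℝ)` (membership criterion `k (q • τ) = k τ`),
there is a finite `F' ⊆ ℝ²` such that every eigenvector of every parabolic lift `t ∈ π⁻¹Λ̄` is moved by a
lift `g ∈ π⁻¹Λ̄` into a line through `F'` — hypothesis (FC) of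
`HolRS.finiteIndex_subgroupOf_normalizer_of_cusps`.  Proof: `ℂ ∖ F = (ℂ ∪ {∞}) ∖ (F ∪ {∞})` inside the
compact Riemann sphere; transport `k` along the open holomorphic embedding `ℂ ↪ ℂ ∪ {∞}` (a
homeomorphism onto its image, Mathlib `IsCoveringMap.homeomorph_comp`; holomorphy by the tree's
`RiemannSphere.mdifferentiableAt_coe_comp_iff`) and apply `HolRS.cuspClasses_finite'` — the deck group
and its membership criterion are unchanged.
[cite: MochizukiAbsTopIII2015, Proposition 4.2 (i) proof p.106] [cite: FarkasKra1992, §I.1.3] -/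
theorem cuspClasses_finite_planeComplFinite {F : Set ℂ} (hF : F.Finite)
    {k : ℍ → (planeComplFinite F hF).carrier} (hk : IsCoveringMap k)
    (dk : MDifferentiable 𝓘(ℂ, ℂ) 𝓘(ℂ, ℂ) k)
    (Λ : Subgroup PSL2R) (hΛ : ∀ q : PSL2R, q ∈ Λ ↔ ∀ τ : ℍ, k (q • τ) = k τ) :
    ∃ F' : Finset (Fin 2 → ℝ), ∀ t : SL(2, ℝ),
      (QuotientGroup.mk' (Subgroup.center SL(2, ℝ)) t : PSL2R) ∈ Λ →
      (t : Matrix (Fin 2) (Fin 2) ℝ).IsParabolic →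
      ∀ v : Fin 2 → ℝ, v ≠ 0 → (∃ c : ℝ, (t : Matrix (Fin 2) (Fin 2) ℝ) *ᵥ v = c • v) →
      ∃ g : SL(2, ℝ), (QuotientGroup.mk' (Subgroup.center SL(2, ℝ)) g : PSL2R) ∈ Λ ∧
        ∃ w ∈ F', ∃ c : ℝ, (g : Matrix (Fin 2) (Fin 2) ℝ) *ᵥ v = c • w := by
  classical
  -- the punctured sphere `U' = ι(ℂ ∖ F) ⊆ ℂ ∪ {∞}`
  let ι : ℂ → OnePoint ℂ := (↑)
  have hι : IsOpenEmbedding ι := OnePoint.isOpenEmbedding_coe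
  let U' : Opens (OnePoint ℂ) := ⟨ι '' Fᶜ, hι.isOpenMap _ hF.isClosed.isOpen_compl⟩
  have hU'coe : (U' : Set (OnePoint ℂ)) = ι '' Fᶜ := rfl
  have hU' : IsConnected (U' : Set (OnePoint ℂ)) := by
    rw [hU'coe]
    exact (isConnected_compl_finite hF).image ι OnePoint.continuous_coe.continuousOn
  have hS' : ((U' : Set (OnePoint ℂ))ᶜ).Finite := by
    refine ((hF.image ι).insert (∞ : OnePoint ℂ)).subset fun p hp => ?_
    rw [hU'coe] at hp
    induction p using OnePoint.rec with
    | infty => exact mem_insert _ _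
    | coe z =>
      refine mem_insert_of_mem _ ⟨z, ?_, rfl⟩
      by_contra hz
      exact hp ⟨z, hz, rfl⟩
  -- the homeomorphism `ℂ ∖ F ≃ₜ U'` induced by `ι`, with inverse the finite chart
  have hmem : ∀ x : (planeComplFinite F hF).carrier, ι x.1 ∈ (U' : Set (OnePoint ℂ)) := fun x =>
    ⟨x.1, x.2, rfl⟩
  have hmem' : ∀ y : U', RiemannSphere.coeChart y.1 ∈ ((⟨Fᶜ, hF.isClosed.isOpen_compl⟩ : Opens ℂ) : Set ℂ) := by
    rintro ⟨_, z, hz, rfl⟩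
    rw [RiemannSphere.coeChart_coe]
    exact hz
  let e : (planeComplFinite F hF).carrier ≃ₜ U' :=
    { toFun := fun x => ⟨ι x.1, hmem x⟩
      invFun := fun y => ⟨RiemannSphere.coeChart y.1, hmem' y⟩
      left_inv := fun x => Subtype.ext (RiemannSphere.coeChart_coe x.1)
      right_inv := by
        rintro ⟨_, z, hz, rfl⟩
        exact Subtype.ext (by simp [ι])
      continuous_toFun := (OnePoint.continuous_coe.comp continuous_subtype_val).subtype_mk _
      continuous_invFun := by
        refine Continuous.subtype_mk ?_ _
        refine RiemannSphere.coeChart.continuousOn.comp_continuous continuous_subtype_val ?_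
        rintro ⟨_, z, -, rfl⟩
        rw [RiemannSphere.coeChart_source]
        exact ⟨z, rfl⟩ }
  have he : ∀ x, (e x).1 = ι x.1 := fun x => rfl
  -- the transported covering
  let k' : ℍ → (ofOpens U' hU').carrier := fun τ => e (k τ)
  have hk' : IsCoveringMap k' := hk.homeomorph_comp e
  have dk' : MDifferentiable 𝓘(ℂ, ℂ) 𝓘(ℂ, ℂ) k' := by
    intro τ
    have h1 : MDifferentiableAt 𝓘(ℂ, ℂ) 𝓘(ℂ, ℂ) (Subtype.val ∘ k) τ :=
      (ChartedSpace.liftPropWithinAt_subtypeVal_comp_iff ..).mpr (dk τ)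
    have h2 : MDifferentiableAt 𝓘(ℂ, ℂ) 𝓘(ℂ, ℂ) (fun σ : ℍ => ι ((Subtype.val ∘ k) σ)) τ :=
      RiemannSphere.mdifferentiableAt_coe_comp_iff.mpr h1
    have h3 : (Subtype.val ∘ k') = fun σ : ℍ => ι ((Subtype.val ∘ k) σ) := rfl
    have h4 : MDifferentiableAt 𝓘(ℂ, ℂ) 𝓘(ℂ, ℂ) (Subtype.val ∘ k') τ := by rw [h3]; exact h2
    exact (ChartedSpace.liftPropWithinAt_subtypeVal_comp_iff ..).mp h4
  have hΛ' : ∀ q : PSL2R, q ∈ Λ ↔ ∀ τ : ℍ, k' (q • τ) = k' τ := by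
    intro q
    rw [hΛ q]
    refine forall_congr' fun τ => ⟨fun h => ?_, fun h => e.injective h⟩
    show e (k (q • τ)) = e (k τ)
    rw [h]
  -- (FC) for `k'` is (FC) for `k`: the deck group and its lifts are the same
  exact cuspClasses_finite' (M := OnePoint ℂ) U' hU' hS' hk' dk' Λ hΛ'

end HolRS

end Literature.AnabelianGeometry.AbsoluteAnabelian

end
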